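import Mathlib.MeasureTheory.Measure.Haar.InnerProductSpace
import Mathlib.MeasureTheory.Integral.Bochner.Set
import Mathlib.MeasureTheory.Function.LocallyIntegrable
import Mathlib.MeasureTheory.Function.StronglyMeasurable.Inner
import Mathlib.Analysis.Calculus.FDeriv.Basic
import Mathlib.Analysis.Normed.Operator.BoundedLinearMaps
import HarnessLib

/-!
# Crux `BlockLipschitzL` (stmt-QuantumFields-23533) ∕ `HistoryTailL` (stmt-QuantumFields-19936), LINE 25 «CompactnessTransfer»,
# stub S1″ row (M) «MONOTONICITY» — FILE γ-LETTERS «TRANSPORTED DENSITY AND INTEGRABILITY LETTERS»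

Cell `ym3-torus` (YM ladder rung R3 = continuum SU(2) Yang–Mills on T³ — a RUNG, NOT the Clay problem: not d = 4, not
infinite volume, not a mass gap); WIDTH helper seat `ym-ust-19936-w2` g13.  Helper `--supports stmt-QuantumFields-19936`;
THEOREMS ONLY (0 `def`, 0 `sorry`, default heartbeats); imports: Mathlib only (+ HarnessLib).

WHAT THIS FILE DOES.  Letters for FILE γ `PoincareLipschitzAxialStationarity` (axial stationarity of ball minimisers) and
FILE δ1 `PoincareLipschitzRadialVariation`: §1 the pointwise algebra of the density transported by an axial shear
(★ `jacobian_mul_transportedDensity`: `(1 − c e_k)·Σ_i‖G(A e_i)‖² = Σ_i[(1 − c e_k)‖Ge_i‖² + 2·c e_i·⟪Ge_i,Ge_k⟫ + (c e_i)²∕(1 − c e_k)·‖Ge_k‖²]`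
for `A = id + (1 − c e_k)⁻¹ • c ⊗ e_k`), §2 integrability of the density pieces `‖Ge_i‖²`, `⟪Ge_i,Ge_k⟫` and of the
first-variation integrand `Σ_i 2∂_if⟪Ge_i,Ge_k⟫ − ∂_kf·Σ_i‖Ge_i‖²` where the density `Σ_i‖Ge_i‖²` is integrable.

HONEST SCOPE.  Linear algebra ∕ integrability bookkeeping; nothing of (M), (C), (R), S1″, S2♭″, `hHalvingBand`, K1,
`MeanDeviationL`, `BlockLipschitzL`, `HistoryTailL` is proved here.  YM₃ on T³ is rung R3, not Clay; YM gap NOT proved.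

References: L. Simon, Theorems on Regularity and Singularity of Energy Minimizing Maps (1996) [Simon1996] (§2.2 (v), §2.4).
-/

set_option autoImplicit false

noncomputable section

open MeasureTheory Set Function Filter Topology Metric TopologicalSpace
open scoped RealInnerProductSpace BigOperators

namespace Summit.QuantumFields.YangMills.Theorems.PoincareLipschitzAxialStationarityLetters

variable {F : Type*} [NormedAddCommGroup F] [InnerProductSpace ℝ F]

/-! ## §1 Pointwise algebra of the transported density -/

/-- **One summand of the transported density**: `J·‖g_i + (J⁻¹b)•g_k‖² = J‖g_i‖² + 2b⟪g_i,g_k⟫ + (b²∕J)‖g_k‖²`.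
[folklore] -/
theorem jacobian_mul_norm_add_smul_sq (gi gk : F) {J : ℝ} (b : ℝ) (hJ : J ≠ 0) :
    J * ‖gi + (J⁻¹ * b) • gk‖ ^ 2 = J * ‖gi‖ ^ 2 + 2 * b * ⟪gi, gk⟫ + b ^ 2 / J * ‖gk‖ ^ 2 := by
  rw [norm_add_sq_real, inner_smul_right, norm_smul, mul_pow, Real.norm_eq_abs, sq_abs]
  field_simp

/-- ★ **THE TRANSPORTED DENSITY IS A RATIONAL FUNCTION OF `Dh`.**  For a continuous linear `G` and a linear form `c` with
`c e_k ≠ 1` (`e_i` the standard basis of `ℝ³`, `A := id + (1 − c e_k)⁻¹ • c ⊗ e_k` the inverse shear derivative of FILE α):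
`(1 − c e_k) · Σ_i ‖G(A e_i)‖² = Σ_i [ (1 − c e_k)‖G e_i‖² + 2·c e_i·⟪G e_i, G e_k⟫ + (c e_i)²∕(1 − c e_k)·‖G e_k‖² ]`.
[folklore] -/
theorem jacobian_mul_transportedDensity (G : EuclideanSpace ℝ (Fin 3) →L[ℝ] F)
    (c : EuclideanSpace ℝ (Fin 3) →L[ℝ] ℝ) (k : Fin 3) (hc : c (EuclideanSpace.single k (1:ℝ)) ≠ 1) :
    (1 - c (EuclideanSpace.single k (1:ℝ))) * ∑ i : Fin 3,
        ‖G ((ContinuousLinearMap.id ℝ (EuclideanSpace ℝ (Fin 3)) + (1 - c (EuclideanSpace.single k (1:ℝ)))⁻¹ •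
          c.smulRight (EuclideanSpace.single k (1:ℝ))) (EuclideanSpace.single i (1:ℝ)))‖ ^ 2 =
      ∑ i : Fin 3, ((1 - c (EuclideanSpace.single k (1:ℝ))) * ‖G (EuclideanSpace.single i (1:ℝ))‖ ^ 2 +
        2 * c (EuclideanSpace.single i (1:ℝ)) *
          ⟪G (EuclideanSpace.single i (1:ℝ)), G (EuclideanSpace.single k (1:ℝ))⟫ +
        c (EuclideanSpace.single i (1:ℝ)) ^ 2 / (1 - c (EuclideanSpace.single k (1:ℝ))) *
          ‖G (EuclideanSpace.single k (1:ℝ))‖ ^ 2) := by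
  have hJ : (1 - c (EuclideanSpace.single k (1:ℝ))) ≠ 0 := sub_ne_zero.mpr (Ne.symm hc)
  rw [Finset.mul_sum]
  refine Finset.sum_congr rfl fun i _ => ?_
  have hA : (ContinuousLinearMap.id ℝ (EuclideanSpace ℝ (Fin 3)) + (1 - c (EuclideanSpace.single k (1:ℝ)))⁻¹ •
      c.smulRight (EuclideanSpace.single k (1:ℝ))) (EuclideanSpace.single i (1:ℝ)) =
      EuclideanSpace.single i (1:ℝ) +
        ((1 - c (EuclideanSpace.single k (1:ℝ)))⁻¹ * c (EuclideanSpace.single i (1:ℝ))) • EuclideanSpace.single k (1:ℝ) := by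
    simp only [add_apply, ContinuousLinearMap.id_apply, smul_apply, ContinuousLinearMap.smulRight_apply, smul_smul]
  rw [hA, map_add, map_smul]
  exact jacobian_mul_norm_add_smul_sq _ _ _ hJ

/-- **The standard basis vectors of `ℝ³` are unit vectors.** [folklore] -/
theorem norm_single_one (k : Fin 3) : ‖(EuclideanSpace.single k (1:ℝ) : EuclideanSpace ℝ (Fin 3))‖ = 1 := by
  simp

/-- **Components of a bounded form are bounded**: `|c e_j| ≤ M` when `‖c‖ ≤ M`. [folklore] -/
theorem abs_apply_single_le {c : EuclideanSpace ℝ (Fin 3) →L[ℝ] ℝ} {M : ℝ} (hc : ‖c‖ ≤ M) (j : Fin 3) :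
    |c (EuclideanSpace.single j (1:ℝ))| ≤ M := by
  have := c.le_of_opNorm_le hc (EuclideanSpace.single j (1:ℝ))
  rw [Real.norm_eq_abs, norm_single_one, mul_one] at this
  exact this

/-! ## §2 Integrability letters for the density pieces -/


/-- **Each squared partial is integrable where the density is.** [folklore] -/
theorem integrableOn_norm_sq_apply {S : Set (EuclideanSpace ℝ (Fin 3))} {G : EuclideanSpace ℝ (Fin 3) → EuclideanSpace ℝ (Fin 3) →L[ℝ] F}
    (hGm : AEStronglyMeasurable G (volume.restrict S))
    (hGi : IntegrableOn (fun x => ∑ i : Fin 3, ‖G x (EuclideanSpace.single i (1:ℝ))‖ ^ 2) S volume) (j : Fin 3) :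
    IntegrableOn (fun x => ‖G x (EuclideanSpace.single j (1:ℝ))‖ ^ 2) S volume := by
  have hm : AEStronglyMeasurable (fun x => ‖G x (EuclideanSpace.single j (1:ℝ))‖ ^ 2) (volume.restrict S) :=
    ((ContinuousLinearMap.apply ℝ F (EuclideanSpace.single j (1:ℝ))).continuous.comp_aestronglyMeasurable hGm).norm.pow 2
  refine Integrable.mono' hGi hm (Filter.Eventually.of_forall fun x => ?_)
  rw [Real.norm_eq_abs, abs_of_nonneg (sq_nonneg _)]
  exact Finset.single_le_sum (f := fun i : Fin 3 => ‖G x (EuclideanSpace.single i (1:ℝ))‖ ^ 2)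
    (fun i _ => sq_nonneg _) (Finset.mem_univ j)

/-- **Each product of partials is integrable where the density is** (`|⟪g_i,g_k⟫| ≤ (‖g_i‖² + ‖g_k‖²)∕2`). [folklore] -/
theorem integrableOn_inner_apply {S : Set (EuclideanSpace ℝ (Fin 3))} {G : EuclideanSpace ℝ (Fin 3) → EuclideanSpace ℝ (Fin 3) →L[ℝ] F}
    (hGm : AEStronglyMeasurable G (volume.restrict S))
    (hGi : IntegrableOn (fun x => ∑ i : Fin 3, ‖G x (EuclideanSpace.single i (1:ℝ))‖ ^ 2) S volume) (j k : Fin 3) :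
    IntegrableOn (fun x => ⟪G x (EuclideanSpace.single j (1:ℝ)), G x (EuclideanSpace.single k (1:ℝ))⟫) S volume := by
  have hmj : AEStronglyMeasurable (fun x => G x (EuclideanSpace.single j (1:ℝ))) (volume.restrict S) :=
    (ContinuousLinearMap.apply ℝ F (EuclideanSpace.single j (1:ℝ))).continuous.comp_aestronglyMeasurable hGm
  have hmk : AEStronglyMeasurable (fun x => G x (EuclideanSpace.single k (1:ℝ))) (volume.restrict S) :=
    (ContinuousLinearMap.apply ℝ F (EuclideanSpace.single k (1:ℝ))).continuous.comp_aestronglyMeasurable hGm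
  have hI : IntegrableOn (fun x => ‖G x (EuclideanSpace.single j (1:ℝ))‖ ^ 2 + ‖G x (EuclideanSpace.single k (1:ℝ))‖ ^ 2)
      S volume := (integrableOn_norm_sq_apply hGm hGi j).add (integrableOn_norm_sq_apply hGm hGi k)
  refine Integrable.mono' hI (hmj.inner hmk) (Filter.Eventually.of_forall fun x => ?_)
  simp only [Real.norm_eq_abs]
  have h1 := abs_real_inner_le_norm (G x (EuclideanSpace.single j (1:ℝ))) (G x (EuclideanSpace.single k (1:ℝ)))
  nlinarith [sq_nonneg (‖G x (EuclideanSpace.single j (1:ℝ))‖ - ‖G x (EuclideanSpace.single k (1:ℝ))‖),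
    norm_nonneg (G x (EuclideanSpace.single j (1:ℝ))), norm_nonneg (G x (EuclideanSpace.single k (1:ℝ)))]

/-- **A bounded continuous multiplier preserves integrability on a measurable set.** [folklore] -/
theorem integrableOn_continuous_mul {S : Set (EuclideanSpace ℝ (Fin 3))} {c g : EuclideanSpace ℝ (Fin 3) → ℝ}
    (hc : Continuous c) {C : ℝ} (hC : ∀ x, |c x| ≤ C) (hg : IntegrableOn g S volume) :
    IntegrableOn (fun x => c x * g x) S volume :=
  Integrable.bdd_mul hg (hc.aestronglyMeasurable.restrict) (Filter.Eventually.of_forall fun x => by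
    rw [Real.norm_eq_abs]; exact hC x)

/-- ★ **THE FIRST-VARIATION INTEGRAND IS INTEGRABLE** where the density is, for any `f` with continuous bounded
gradient: `Σ_i 2·∂_if·⟪Ge_i, Ge_k⟫ − ∂_kf·Σ_i‖Ge_i‖²`.  (Exported for the radial sum of FILE δ.) [folklore] -/
theorem integrableOn_firstVariation {S : Set (EuclideanSpace ℝ (Fin 3))}
    {G : EuclideanSpace ℝ (Fin 3) → EuclideanSpace ℝ (Fin 3) →L[ℝ] F}
    (hGm : AEStronglyMeasurable G (volume.restrict S))
    (hGi : IntegrableOn (fun x => ∑ i : Fin 3, ‖G x (EuclideanSpace.single i (1:ℝ))‖ ^ 2) S volume)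
    {f : EuclideanSpace ℝ (Fin 3) → ℝ} (hf'c : Continuous (fderiv ℝ f)) {M : ℝ} (hM : ∀ x, ‖fderiv ℝ f x‖ ≤ M)
    (k : Fin 3) :
    IntegrableOn (fun z => (∑ i : Fin 3, 2 * fderiv ℝ f z (EuclideanSpace.single i (1:ℝ)) *
          ⟪G z (EuclideanSpace.single i (1:ℝ)), G z (EuclideanSpace.single k (1:ℝ))⟫) -
        fderiv ℝ f z (EuclideanSpace.single k (1:ℝ)) * ∑ i : Fin 3, ‖G z (EuclideanSpace.single i (1:ℝ))‖ ^ 2)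
      S volume := by
  have If' : ∀ j, Continuous fun z => fderiv ℝ f z (EuclideanSpace.single j (1:ℝ)) :=
    fun j => hf'c.clm_apply continuous_const
  have hfj : ∀ j z, |fderiv ℝ f z (EuclideanSpace.single j (1:ℝ))| ≤ M := fun j z => abs_apply_single_le (hM z) j
  refine (integrable_finsetSum _ fun i _ => ?_).sub ?_
  · have hc2 : Continuous fun z => 2 * fderiv ℝ f z (EuclideanSpace.single i (1:ℝ)) :=
      continuous_const.mul (If' i)
    exact integrableOn_continuous_mul hc2 (C := 2 * M)
      (fun z => by rw [abs_mul, abs_two]; linarith [hfj i z]) (integrableOn_inner_apply hGm hGi i k)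
  · exact integrableOn_continuous_mul (If' k) (hfj k) hGi

end Summit.QuantumFields.YangMills.Theorems.PoincareLipschitzAxialStationarityLetters

end
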